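import Literature.Topology.FourManifolds.TrisectionsMidSectorHandles
import Literature.Topology.FourManifolds.TrisectionsH23Handles
import Literature.Topology.FourManifolds.TrisectionsSectorOneHandles
import Literature.Topology.FourManifolds.TrisectionsSectorThreeHandles
import Literature.Topology.FourManifolds.TrisectionsAssemblyHandles
import Literature.Topology.FourManifolds.TrisectionsHandlebodies
import Literature.Topology.FourManifolds.TrisectionsFrameData
import Literature.Topology.FourManifolds.TrisectionsHeegaardDataStabilized
import Literature.Topology.FourManifolds.TrisectionsMidSectorProfiles
import Literature.Topology.FourManifolds.TrisectionsInstantiation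
import Literature.Topology.FourManifolds.TrisectionsExistence
import Literature.Topology.FourManifolds.SPC4HandlesSelfIndexingProofs
import Literature.Topology.FourManifolds.MorseAffine
import Literature.Topology.FourManifolds.TubeFlowGeometry
import HarnessLib

/-!
# Trisections from the parameter data: assembling the seven handle decompositions

Topic `Literature/Topology/FourManifolds`; the last assembly step for the fact seat
`provefact-Literature.Topology.FourManifolds.exists_isBalancedGKTrisection` (Gay–Kirby 2016,
Thm. 4 via §4, Lemma 14).  Everything in this file is **proved**; no definitions, no named facts.

Given the straightening data `T : TriData` of the three sectors `X₁ = {f ≤ 3/2 - ν(φ - 3/2)}`,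
`X₂`, `X₃` (with `f`, `φ = B.g` the Morse function and the Heegaard function of the level), a
tube frame `𝔉` (the `2`-handle boxes and the tube form of `φ`), belt parameters `𝔓` (for `H₂₃`)
and middle-sector parameters `𝔔` (for `X₂`), together with the handle counts of `f` below `a`
and above `c` and the genus bookkeeping of `φ`, `TubeFrame.exists_isGKTrisection_of_params`
combines

* `X₁ ≅ ♮^{k₁} S¹ × B³` (`BevelData.hasHandleDecomposition_sector_of_small`),
* `X₂ ≅ ♮^{k₂} S¹ × B³` for some `k₂` (`MidParams.exists_hasHandleDecomposition_X₂_handleCount`),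
* `X₃ ≅ ♮^{k₃} S¹ × B³` (`SectorThreeParams.hasHandleDecomposition_X₃_handleCount`),
* `H₁₂`, `H₃₁`, `H₂₃ ≅ ♮^{gen} S¹ × B²` (the hypotheses on `{φ ≤ b}`, `{b ≤ φ}` and
  `BeltParams.hasHandleDecomposition_H₂₃`)

into **`IsGKTrisection X gen ![k₁, k₂, k₃] T.sectors` with `k₂ + m = gen`** (`m` the number of
`2`-handles; the genus bookkeeping `c_i(φ, <b) = #critY_i + 2m` of `TrisectionsH23Handles.lean`)
by `TriData.isGKTrisection_of_handles` (Gay–Kirby, Lemma 14: "the result is a `(g, k)`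
trisection"; here `k₂ = g - m` as printed: *"`X₂` is diffeomorphic to `♮ᵏ S¹ × B³` because the
`2`-handles cancel `g - k` of the `S¹ × B³`'s"*).

## References

* D. Gay, R. Kirby, *Trisecting 4-manifolds*, Geom. Topol. 20 (2016) 3097–3132
  (arXiv:1205.1565): Def. 1; §4, Lemma 14 and its proof; Thm. 4. [GayKirby2016]
-/

open scoped Manifold ContDiff Topology
open Set Function Filter

noncomputable section

universe u

namespace Literature.Topology.FourManifolds

variable {X : Type u} [TopologicalSpace X] [T2Space X] [CompactSpace X] [SecondCountableTopology X]
  [ChartedSpace (EuclideanSpace ℝ (Fin 4)) X] [IsManifold (𝓡 4) ∞ X]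

namespace BiCollar.TriData.TubeFrame

variable {B : BiCollar X} {T : B.TriData} {ι : Type} [Fintype ι] (𝔉 : T.TubeFrame ι)

/-- **The trisection from the parameter data** (Gay–Kirby, Lemma 14): with belt parameters `𝔓`
and middle-sector parameters `𝔔` over a tube frame `𝔉` of `T`, if `φ = B.g` is Morse with
critical points of index `≤ 1` below `b`, the Heegaard surface is connected,
`gen + c₀(φ, <b) = c₁(φ, <b) + 1`, `{φ ≤ b}` and `{b ≤ φ}` are `♮^{gen} S¹ × B²`, `f` has one
critical point of index `0`, `k₁` of index `1` and no others below `a`, one of index `4`, `k₃`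
of index `3` and none of index `≤ 2` above `c`, and no critical value in `(c, c + Γ + ε + σ₀]`
where `|φ ∘ λ - b| ≤ Γ`, then `(X₁, X₂, X₃)` is a `(gen; k₁, k₂, k₃)`-trisection of `X` for some
`k₂`. [cite: GayKirby2016, §4, Lemma 14 and its proof] -/
theorem exists_isGKTrisection_of_params (𝔓 : 𝔉.BeltParams) (𝔔 : 𝔉.MidParams)
    (hgM : IsMorse (𝓡 3) B.g) (hεT : 0 < 𝔉.εT)
    (hidx : ∀ y, IsMCriticalPt (𝓡 3) B.g y → B.g y < B.b → morseIndex (𝓡 3) B.g y ≤ 1)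
    (hsurf : IsConnected B.surface) {gen k₁ k₃ : ℕ}
    (hgen : gen + (criticalSetOfIndex (𝓡 3) B.g 0 ∩ B.g ⁻¹' Iio B.b).ncard =
      (criticalSetOfIndex (𝓡 3) B.g 1 ∩ B.g ⁻¹' Iio B.b).ncard + 1)
    (hH₁₂ : HasHandleDecomposition 2 (RegularSublevel B.hg) (handleCount 1 gen))
    (hH₃₁ : HasHandleDecomposition 2 (RegularSuperlevel B.hg) (handleCount 1 gen))
    (h₁count : ∀ i, (criticalSetOfIndex (𝓡 4) B.f i ∩ B.f ⁻¹' Iio B.a).ncard = handleCount 1 k₁ i)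
    {Γ σ₀ : ℝ} (hΓ : ∀ x, |B.gFun x| ≤ Γ) (hσ : 0 < σ₀) (hσδ : 2 * σ₀ ≤ B.U.δ)
    (hgap : ∀ q, IsMCriticalPt (𝓡 4) B.f q → B.f q ≤ T.c ∨ T.c + Γ + T.ε + σ₀ < B.f q)
    (h4 : (criticalSetOfIndex (𝓡 4) B.f 4 ∩ B.f ⁻¹' Ioi T.c).ncard = 1)
    (h3 : (criticalSetOfIndex (𝓡 4) B.f 3 ∩ B.f ⁻¹' Ioi T.c).ncard = k₃)
    (hlt : ∀ i, i ≤ 2 → (criticalSetOfIndex (𝓡 4) B.f i ∩ B.f ⁻¹' Ioi T.c).ncard = 0) :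
    ∃ k₂ : ℕ, k₂ + Fintype.card ι = gen ∧ IsGKTrisection X gen ![k₁, k₂, k₃] T.sectors := by
  have hc2 := 𝔔.hc2
  -- `X₁`
  have h₁ : letI := T.D.cornerSliceAtlas.chartedSpace
      HasHandleDecomposition 3 T.D.sector (handleCount 1 k₁) := by
    have h := T.D.hasHandleDecomposition_sector_of_small T.Fr 𝔔.abs_deriv_le 𝔔.hκ
    have heq : (fun i => (criticalSetOfIndex (𝓡 4) B.f i ∩ B.f ⁻¹' Iio B.a).ncard) = handleCount 1 k₁ :=
      funext h₁count
    rw [heq] at h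
    exact h
  -- `H₂₃`
  have hH₂₃ := 𝔓.hasHandleDecomposition_H₂₃ hc2 hgM hεT hidx hsurf hgen
  -- the two faces of `X₂` are connected
  have h₂₃conn : IsConnected (T.X₂ ∩ T.X₃) := by
    letI := (T.bsliceAtlas hc2 𝔉.two_mul_ε_le 𝔉.linkCondition).chartedSpace
    haveI := (T.bsliceAtlas hc2 𝔉.two_mul_ε_le 𝔉.linkCondition).isManifold
    haveI : CompactSpace T.H₂₃ := T.compactSpace_H₂₃
    haveI : ConnectedSpace T.H₂₃ := connectedSpace_of_hasHandleDecomposition_handleCount_one hH₂₃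
    exact isConnected_iff_connectedSpace.2 ‹ConnectedSpace T.H₂₃›
  have h₁₂conn : IsConnected (T.X₂ ∩ T.X₁) := by
    haveI : ConnectedSpace (RegularSublevel B.hg) := connectedSpace_of_hasHandleDecomposition_handleCount_one hH₁₂
    rw [inter_comm, ← T.range_graphMap₁₂ hc2]
    exact isConnected_range (continuous_graphMap T.τH B.hg)
  -- `X₂`, with `k₂ + m = gen` (`c_i(φ, <b) = #critY_i + 2m`)
  obtain ⟨k₂, hk₂, h₂⟩ := 𝔔.exists_hasHandleDecomposition_X₂_handleCount hgM hεT hidx h₁₂conn h₂₃conn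
  have hk₂m : k₂ + Fintype.card ι = gen := by
    have h0 := 𝔓.ncard_crit_g_eq hgM hεT (i := 0) (Or.inl rfl)
    have h1 := 𝔓.ncard_crit_g_eq hgM hεT (i := 1) (Or.inr rfl)
    have hk₂' : k₂ + ((𝔉.critY 0).ncard + Fintype.card ι) = (𝔉.critY 1).ncard + 1 := by
      simpa [TubeFrame.countMid] using hk₂
    have hgen' : gen + ((𝔉.critY 0).ncard + 2 * Fintype.card ι) = ((𝔉.critY 1).ncard + 2 * Fintype.card ι) + 1 := by
      rw [← h0, ← h1]; exact hgen
    omega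
  -- `X₃`
  obtain ⟨P⟩ := T.nonempty_sectorThreeParams 𝔔.abs_deriv_le 𝔔.hκ hΓ hσ hσδ hgap
  have h₃ := P.hasHandleDecomposition_X₃_handleCount hc2 𝔉.two_mul_ε_le 𝔉.linkCondition h4 h3 hlt
  exact ⟨k₂, hk₂m, T.isGKTrisection_of_handles hc2 𝔉.two_mul_ε_le 𝔉.linkCondition h₁ h₂ h₃ hH₁₂ hH₃₁ hH₂₃⟩

end BiCollar.TriData.TubeFrame

end Literature.Topology.FourManifolds

end

/-!
# Gay–Kirby 2016, Thm. 4 (existence of trisections), the construction of §4, Lemma 14 carried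
# out: every closed connected smooth `4`-manifold has a `(g; k₁, k₂, k₁)`-trisection

Topic `Literature/Topology/FourManifolds`; for the fact seat
`provefact-Literature.Topology.FourManifolds.exists_isBalancedGKTrisection` (Gay–Kirby 2016,
Thm. 4).  Everything in this file is **proved**; no definitions, no named facts.

`exists_isGKTrisection`: **every closed connected smooth `4`-manifold `X` admits a
Gay–Kirby trisection `X = X₁ ∪ X₂ ∪ X₃`** (`IsGKTrisection X g ![k₁, k₂, k₁] S`), obtained
exactly as in the proof of Gay–Kirby's Lemma 14 from a self-indexing Morse function with one
critical point of index `0` and of index `4` and as many of index `1` as of index `3`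
(`exists_isSelfIndexing_ncard_one_eq_ncard_three`, fed by the tree's theorem
`exists_isMorse_isSelfIndexing_holds`), rescaled by `3`; a gradient-like field and Milnor boxes
about the index-`2` points (`TrisectionsFrameData.lean`); the Heegaard function of the level
`f⁻¹(6 - η)` in tube form about the attaching circles (`TrisectionsHeegaardData.lean`); the
straightening data of the three sectors (`TriData.ofLevels`, `TrisectionsInstantiation.lean`),
their tube frame, belt and middle-sector parameters (with the explicit profiles of
`TrisectionsMidSectorProfiles.lean`); and the assembly
`TubeFrame.exists_isGKTrisection_of_params` (above); corollary
`gkTrisectionGenus_ne_top` (the trisection genus of `Trisections.lean` is finite).  The genus is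
that of the Heegaard splitting of the level produced by `TubeSystem.exists_heegaardFunction`,
stabilised (`exists_heegaardData_add`, `TrisectionsHeegaardDataStabilized.lean`) to
`max gen₀ (k₁ + m)`; the trisection is `(g; k₁, k₂, k₃)` with `k₃ = k₁ =` the number of
index-`1` critical points and `k₁ ≤ k₂ = g - m` — balanced unless `gen₀ > k₁ + m`, the case in
which Gay–Kirby raise `k₁` and `m` by cancelling pairs (p. 14), not carried out here.

## References

* D. Gay, R. Kirby, *Trisecting 4-manifolds*, Geom. Topol. 20 (2016) 3097–3132
  (arXiv:1205.1565): Def. 1; §4, Lemmas 13–14; Thm. 4. [GayKirby2016]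
* J. Milnor, *Lectures on the h-cobordism theorem* (1965), Thms. 2.7, 3.4, 4.8, 8.1. [MilnorHCobordism1965]
* J. Milnor, *Morse theory* (1963), §3. [Milnor1963]
-/

open scoped Manifold ContDiff Topology
open Set Function Filter Metric

noncomputable section

universe u

namespace Literature.Topology.FourManifolds

/-! ### Slope bounds for the transition profiles -/

/-- **The transition `A ↦ smoothTransition((A - r₀)/(r₁ - r₀))` has bounded slope.** [folklore] -/
theorem exists_abs_deriv_smoothTransition_comp_le {r₀ r₁ : ℝ} (h : r₀ < r₁) :
    ∃ L : ℝ, 0 ≤ L ∧ ∀ A, |deriv (fun A => Real.smoothTransition ((A - r₀) / (r₁ - r₀))) A| ≤ L := by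
  set g : ℝ → ℝ := fun A => Real.smoothTransition ((A - r₀) / (r₁ - r₀)) with hg
  have hgs : ContDiff ℝ ∞ g :=
    Real.smoothTransition.contDiff.comp ((contDiff_id.sub contDiff_const).div_const _)
  have hcont : Continuous (deriv g) := hgs.continuous_deriv (by norm_cast)
  obtain ⟨C, hC⟩ := (isCompact_Icc (a := r₀) (b := r₁)).exists_bound_of_continuousOn hcont.continuousOn
  refine ⟨max C 0, le_max_right _ _, fun A => ?_⟩
  by_cases hA : A ∈ Icc r₀ r₁
  · exact ((Real.norm_eq_abs _).symm.le.trans (hC A hA)).trans (le_max_left _ _)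
  · -- outside `[r₀, r₁]` the profile is locally constant
    have hd : deriv g A = 0 := by
      rcases not_and_or.1 hA with hlt | hgt
      · push Not at hlt
        have hev : g =ᶠ[𝓝 A] fun _ => 0 := by
          filter_upwards [Iio_mem_nhds hlt] with x hx
          have hx' : x < r₀ := hx
          exact Real.smoothTransition.zero_of_nonpos (div_nonpos_of_nonpos_of_nonneg (by linarith) (by linarith))
        rw [hev.deriv_eq, deriv_const]
      · push Not at hgt
        have hev : g =ᶠ[𝓝 A] fun _ => 1 := by
          filter_upwards [Ioi_mem_nhds hgt] with x hx
          have hx' : r₁ < x := hx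
          exact Real.smoothTransition.one_of_one_le ((one_le_div (by linarith)).2 (by linarith))
        rw [hev.deriv_eq, deriv_const]
    rw [hd, abs_zero]; exact le_max_right _ _

/-- The slope bound of the reversed transition `1 - smoothTransition((A - r₂)/(r₃ - r₂))`. [folklore] -/
theorem exists_abs_deriv_one_sub_smoothTransition_comp_le {r₂ r₃ : ℝ} (h : r₂ < r₃) :
    ∃ L : ℝ, 0 ≤ L ∧ ∀ A, |deriv (fun A => 1 - Real.smoothTransition ((A - r₂) / (r₃ - r₂))) A| ≤ L := by
  obtain ⟨L, hL0, hL⟩ := exists_abs_deriv_smoothTransition_comp_le h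
  refine ⟨L, hL0, fun A => ?_⟩
  rw [deriv_const_sub, abs_neg]; exact hL A

/-! ### Belt and middle-sector parameters for the standard tube frame -/

section Params

variable {X : Type u} [TopologicalSpace X] [T2Space X] [CompactSpace X]
  [ChartedSpace (EuclideanSpace ℝ (Fin 4)) X] [IsManifold (𝓡 4) ∞ X]

namespace BiCollar.TriData.TubeFrame

variable {B : BiCollar X} {T : B.TriData} {ι : Type} [Fintype ι] (𝔉 : T.TubeFrame ι)

omit [T2Space X] [CompactSpace X] in
/-- **Belt parameters for the standard tube frame** (`k_g = 1/7`, `g₀ = 0`, `κ_T = 1/(4η)`,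
`P₀ = η²`, `m₀ = 9/28`, `ν² = η/4`, `ε_T ≤ 1/100` small against the slope of the cap profile,
`b > 1/2`). [cite: GayKirby2016, §4, Lemma 14] -/
theorem nonempty_beltParams (hkg : 𝔉.kg = 1 / 7) (hg₀ : 𝔉.g₀ = 0) (hκT : 𝔉.κT = 1 / (4 * 𝔉.η₂))
    (hP₀ : 𝔉.P₀ = 𝔉.η₂ ^ 2) (hm₀ : 𝔉.m₀ = 9 / 28) (hν2 : 𝔉.ν ^ 2 = 𝔉.η₂ / 4) (hεT1 : 𝔉.εT ≤ 1 / 100)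
    (hb : 1 / 2 < B.b) (hεw : T.D.εw < 9 / 28) {L L₂ : ℝ} (hL0 : 0 ≤ L)
    (hL : ∀ A, |deriv (fun A => Real.smoothTransition ((A - 𝔉.η₂ / 16) / (𝔉.η₂ / 8 - 𝔉.η₂ / 16))) A| ≤ L)
    (hL₂0 : 0 ≤ L₂)
    (hL₂ : ∀ A, |deriv (fun A => 1 - Real.smoothTransition ((A - 𝔉.η₂ / 16) / (𝔉.η₂ / 8 - 𝔉.η₂ / 16))) A| ≤ L₂)
    (hεTL : 𝔉.εT ≤ 1 / (32 * 𝔉.η₂ * (L + 1))) : Nonempty 𝔉.BeltParams := by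
  have hη := 𝔉.η₂_pos
  have hεT0 := 𝔉.εT_nonneg
  set τp : ℝ := min (1 / 100) (1 / (448 * 𝔉.η₂ * (L₂ + 1))) with hτpdef
  have hτppos : 0 < τp := lt_min (by norm_num) (by positivity)
  have hτp1 : τp ≤ 1 / 100 := min_le_left _ _
  have hτpL : τp ≤ 1 / (448 * 𝔉.η₂ * (L₂ + 1)) := min_le_right _ _
  have hsmall₁ : 𝔉.kg * 𝔉.εT * L + τp / 1 * L₂ < 𝔉.kg * (𝔉.κT / 𝔉.η₂) * 𝔉.ν ^ 2 := by
    rw [hkg, hκT, hν2, div_one]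
    have hRHS : 1 / 7 * (1 / (4 * 𝔉.η₂) / 𝔉.η₂) * (𝔉.η₂ / 4) = 1 / (112 * 𝔉.η₂) := by field_simp; ring
    rw [hRHS]
    have h1 : 1 / 7 * 𝔉.εT * L ≤ 1 / (224 * 𝔉.η₂) := by
      have h3 : 𝔉.εT * L ≤ 1 / (32 * 𝔉.η₂ * (L + 1)) * L := mul_le_mul_of_nonneg_right hεTL hL0
      have h2 : 1 / (32 * 𝔉.η₂ * (L + 1)) * L ≤ 1 / (32 * 𝔉.η₂) := by
        rw [div_mul_eq_mul_div, one_mul, div_le_div_iff₀ (by positivity) (by positivity)]; nlinarith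
      have h4 : 1 / 7 * (1 / (32 * 𝔉.η₂)) = 1 / (224 * 𝔉.η₂) := by field_simp; ring
      calc 1 / 7 * 𝔉.εT * L = 1 / 7 * (𝔉.εT * L) := by ring
        _ ≤ 1 / 7 * (1 / (32 * 𝔉.η₂)) := mul_le_mul_of_nonneg_left (h3.trans h2) (by norm_num)
        _ = 1 / (224 * 𝔉.η₂) := h4
    have h2 : τp * L₂ < 1 / (224 * 𝔉.η₂) := by
      have : τp * L₂ ≤ 1 / (448 * 𝔉.η₂ * (L₂ + 1)) * L₂ := mul_le_mul_of_nonneg_right hτpL hL₂0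
      have h3 : 1 / (448 * 𝔉.η₂ * (L₂ + 1)) * L₂ < 1 / (224 * 𝔉.η₂) := by
        rw [div_mul_eq_mul_div, one_mul, div_lt_div_iff₀ (by positivity) (by positivity)]; nlinarith
      linarith
    have : 1 / (224 * 𝔉.η₂) + 1 / (224 * 𝔉.η₂) = 1 / (112 * 𝔉.η₂) := by field_simp; ring
    linarith
  have hLle : ∀ A, deriv (fun A => Real.smoothTransition ((A - 𝔉.η₂ / 16) / (𝔉.η₂ / 8 - 𝔉.η₂ / 16))) A ≤ L :=
    fun A => (le_abs_self _).trans (hL A)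
  refine ⟨?_⟩
  exact
    { aR := 𝔉.η₂ / 2, r₀ := 𝔉.η₂ / 16, r₁ := 𝔉.η₂ / 8, r₂ := 𝔉.η₂ / 16, r₃ := 𝔉.η₂ / 8,
      m₁ := min (T.ε / 4) (𝔉.η₂ / 8), τp := τp, β := 1,
      r₀_pos := by positivity, r₀_lt := by linarith, r₂_pos := by positivity, r₂_lt := by linarith,
      r₁_lt := by linarith, r₃_lt := by linarith, aR_le := by linarith,
      m₁_pos := lt_min (by linarith [T.ε_pos]) (by positivity), m₁_le_ε := min_le_left _ _,
      m₁_le_ν := by rw [hν2]; linarith [min_le_right (T.ε / 4) (𝔉.η₂ / 8)],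
      aR_P := by rw [hν2, hP₀]; nlinarith [min_le_right (T.ε / 4) (𝔉.η₂ / 8)],
      τp_pos := hτppos, β_pos := one_pos,
      εw_lt := by rw [hm₀]; exact hεw,
      kg_g₀_le := by rw [hkg, hg₀, hm₀]; nlinarith,
      small₀ := by
        rw [hkg, hκT, hP₀, hm₀]
        have : 1 / 7 * (1 / (4 * 𝔉.η₂) / 𝔉.η₂) * 𝔉.η₂ ^ 2 = 1 / 28 := by field_simp; norm_num
        rw [this]; linarith,
      L := L, deriv_chi_le := hLle, L₂ := L₂, abs_deriv_chi2_le := hL₂, small₁ := hsmall₁ }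

omit [T2Space X] [CompactSpace X] in
/-- **Middle-sector parameters for the standard tube frame** (`k_g = 1/7`, `g₀ = 0`,
`κ_T = 1/(4η)`, `P₀ = η²`, `m₀ = 9/28`, `ν² = η/4`, `η ≤ 1/16`, a thin band and a small rounding
width, `b > 1/2`, and the tube form of `φ` on `{𝒯 < 3}`), with the explicit profiles of
`TrisectionsMidSectorProfiles.lean`: `a_R = 7η/16`, `a_R' = 13η/32`, `ε₀ = η/128`, `θ = 1/1000`,
`K = 16/η + 1`. [cite: GayKirby2016, §4, Lemma 14] -/
theorem nonempty_midParams (hkg : 𝔉.kg = 1 / 7) (hg₀ : 𝔉.g₀ = 0) (hκT : 𝔉.κT = 1 / (4 * 𝔉.η₂))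
    (hP₀ : 𝔉.P₀ = 𝔉.η₂ ^ 2) (hm₀ : 𝔉.m₀ = 9 / 28) (hν2 : 𝔉.ν ^ 2 = 𝔉.η₂ / 4) (hεT1 : 𝔉.εT ≤ 1 / 100)
    (hb : 1 / 2 < B.b) (hη16 : 𝔉.η₂ ≤ 1 / 16) (hδ : B.U.δ ≤ 𝔉.η₂ / 32) (hε : T.ε ≤ 5 * 𝔉.η₂ / 16)
    {Lb : ℝ} (hLb : ∀ s, |deriv T.D.χ₁ s| ≤ Lb) (hκb : T.D.κ * Lb * T.D.χ₂.rOut ≤ 1 / 4)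
    (hform : ∀ j (y : B.Y), RegularLevel.incl B.hf y ∈ (𝔉.boxes.box j).chart.source →
      TubeModel.tube 𝔉.εT 𝔉.κT 𝔉.η₂ ((𝔉.boxes.box j).coord (RegularLevel.incl B.hf y)) < 3 →
      B.g y = 𝔉.kg * TubeModel.tube 𝔉.εT 𝔉.κT 𝔉.η₂ ((𝔉.boxes.box j).coord (RegularLevel.incl B.hf y))) :
    Nonempty 𝔉.MidParams := by
  have hη := 𝔉.η₂_pos
  have hεT0 := 𝔉.εT_nonneg
  have hν := 𝔉.ν_pos
  have hεw0 := T.D.εw_pos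
  have hεwδ : T.D.εw ≤ B.U.δ := T.D.εw_le_δU
  have hc := 𝔉.c_eq
  obtain ⟨θ, hθ⟩ : ∃ θ : ℝ, θ = 1 / 1000 := ⟨_, rfl⟩
  obtain ⟨Kc, hK⟩ : ∃ K : ℝ, K = 16 / 𝔉.η₂ + 1 := ⟨_, rfl⟩
  obtain ⟨aR, haR⟩ : ∃ a : ℝ, a = 7 * 𝔉.η₂ / 16 := ⟨_, rfl⟩
  obtain ⟨aR', haR'⟩ : ∃ a : ℝ, a = 13 * 𝔉.η₂ / 32 := ⟨_, rfl⟩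
  obtain ⟨ε₀, hε₀⟩ : ∃ e : ℝ, e = 𝔉.η₂ / 128 := ⟨_, rfl⟩
  have hθ0 : 0 ≤ θ := by rw [hθ]; norm_num
  have hθpos : 0 < θ := by rw [hθ]; norm_num
  have hK0 : 0 ≤ Kc := by rw [hK]; positivity
  have hK1 : 4 / 𝔉.ν ^ 2 ≤ Kc := by
    rw [hν2, hK, div_div_eq_mul_div]
    have : 4 * 4 / 𝔉.η₂ = 16 / 𝔉.η₂ := by norm_num
    linarith
  have haRpos : 0 < aR := by rw [haR]; positivity
  have hε₀pos : 0 < ε₀ := by rw [hε₀]; positivity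
  have hkgpos : 0 < 𝔉.kg := 𝔉.kg_pos
  have hw_b : MidProfiles.wProf θ 1 (B.b - T.D.εw - 1) B.b = 1 := MidProfiles.wProf_of_ge one_pos (by linarith)
  have hdesign : ∀ a t, 0 ≤ a → a < 2 * aR →
      ChartZone.DesignIneq (fun a => (𝔉.η₂ - a) * (𝔉.ν ^ 2 + a) * MidProfiles.RProf Kc ε₀ aR' a)
        (MidProfiles.wProf θ 1 (B.b - T.D.εw - 1)) (MidProfiles.rhoProf aR) 𝔉.kg 𝔉.εT a t := by
    intro a t ha0 ha
    refine MidProfiles.designIneq_holds hη hν (by rw [hν2]; linarith) haRpos (by rw [haR]; linarith)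
      (by rw [hν2, haR]; linarith) hε₀pos (by rw [haR, haR']; linarith)
      (by rw [hν2, haR', hε₀]; linarith) hK0 hK1 hθ0 one_pos hkgpos hεT0 ?_ ?_ ha0 ha t
    · rw [hθ, hkg]; linarith
    · rw [hθ, hν2, haR, haR', hε₀, hkg]
      have hx : 𝔉.η₂ ^ 2 * 𝔉.εT ≤ 𝔉.η₂ ^ 2 * (1 / 100) := mul_le_mul_of_nonneg_left hεT1 (sq_nonneg _)
      have h0 : 0 ≤ 𝔉.η₂ ^ 2 := sq_nonneg _
      have h1 : 64 * 𝔉.η₂ ^ 2 * (1 / 1000) * (1 / 7) * 𝔉.εT = 64 / 7000 * (𝔉.η₂ ^ 2 * 𝔉.εT) := by ring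
      have h2 : (2 * (13 * 𝔉.η₂ / 32 - 2 * (𝔉.η₂ / 128)) - (𝔉.η₂ - 𝔉.η₂ / 4)) * (7 * 𝔉.η₂ / 16) = 7 / 512 * 𝔉.η₂ ^ 2 := by ring
      rw [h1, h2]; linarith
  have hradial : ∀ a t, 0 ≤ a → a < 2 * aR →
      𝔉.εT * a * (MidProfiles.rhoProf aR a + a * deriv (MidProfiles.rhoProf aR) a) *
          |deriv (MidProfiles.wProf θ 1 (B.b - T.D.εw - 1)) t| * 𝔉.kg * MidProfiles.RProf Kc ε₀ aR' a ≤
        a * MidProfiles.wProf θ 1 (B.b - T.D.εw - 1) t * (-deriv (MidProfiles.RProf Kc ε₀ aR') a) +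
          a ^ 2 * (𝔉.κT / 𝔉.η₂) * |deriv (MidProfiles.wProf θ 1 (B.b - T.D.εw - 1)) t| * 𝔉.kg *
            MidProfiles.RProf Kc ε₀ aR' a := by
    intro a t ha0 ha
    refine MidProfiles.radial_holds haRpos hε₀pos (by rw [haR, haR', hε₀]; linarith) hK0 ?_
      hθ0 one_pos hkgpos.le hεT0 (by rw [hκT]; positivity) ha0 ha t
    rw [hθ, hK, haR, hkg]
    have h1 : 𝔉.εT * (1 / 1000) * (1 / 7) * 72 ≤ 1 := by linarith
    have h2 : (1 : ℝ) ≤ (16 / 𝔉.η₂ + 1) * (7 * 𝔉.η₂ / 16) := by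
      have : (16 / 𝔉.η₂ + 1) * (7 * 𝔉.η₂ / 16) = 7 + 7 * 𝔉.η₂ / 16 := by field_simp
      rw [this]; linarith
    linarith
  have hcolP : 2 * aR * (𝔉.ν ^ 2 + 2 * aR) ≤ 𝔉.P₀ := by
    rw [hν2, haR, hP₀]
    have h1 : 2 * (7 * 𝔉.η₂ / 16) * (𝔉.η₂ / 4 + 2 * (7 * 𝔉.η₂ / 16)) = 63 / 64 * 𝔉.η₂ ^ 2 := by ring
    rw [h1]
    have := sq_nonneg 𝔉.η₂
    linarith
  have hband4 : B.a + 4 * B.U.δ + 2 * T.ε ≤ T.c := by rw [hc, hν2]; linarith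
  have hδw_lt : T.D.εw < (T.c - B.a) / 2 + T.ε := by rw [hc, hν2]; linarith [T.ε_pos]
  have hplateau : 𝔉.η₂ + 𝔉.ν ^ 2 + T.ε + B.U.δ ≤ 𝔉.m₀ := by rw [hν2, hm₀]; linarith
  have htube_top : 𝔉.kg * (1 + 𝔉.κT / 𝔉.η₂ * 𝔉.P₀) ≤ B.b - 𝔉.m₀ := by
    rw [hkg, hκT, hP₀, hm₀]
    have : 1 / (4 * 𝔉.η₂) / 𝔉.η₂ * 𝔉.η₂ ^ 2 = 1 / 4 := by field_simp
    rw [this]; linarith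
  have hκδ' : 𝔉.κT / 𝔉.η₂ * (2 * aR) * (2 * 𝔉.η₂) < 2 * 1 := by
    rw [hκT, haR]
    have : 1 / (4 * 𝔉.η₂) / 𝔉.η₂ * (2 * (7 * 𝔉.η₂ / 16)) * (2 * 𝔉.η₂) = 7 / 16 := by field_simp; ring
    rw [this]; norm_num
  refine ⟨?_⟩
  exact
    { aR := aR, aR' := aR', w := MidProfiles.wProf θ 1 (B.b - T.D.εw - 1), δw := T.D.εw,
      ρ := MidProfiles.rhoProf aR, R₀ := MidProfiles.RProf Kc ε₀ aR', C := 1, L := Lb, δg := 1,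
      aR_pos := haRpos,
      lt_aR' := by rw [hν2, haR']; linarith,
      aR'_lt := by rw [haR, haR']; linarith,
      two_aR_le := by rw [haR]; linarith,
      band_aR := by rw [haR]; linarith,
      band4 := hband4,
      col_P := hcolP,
      w_contDiff := MidProfiles.contDiff_wProf,
      w_pos := MidProfiles.wProf_pos hθ0 one_pos,
      w_deriv_nonpos := MidProfiles.deriv_wProf_nonpos hθ0 one_pos,
      w_deriv_neg := fun t ht => MidProfiles.deriv_wProf_neg hθpos one_pos (by linarith),
      w_const := fun t ht => by
        rw [MidProfiles.wProf_of_ge (θ := θ) (c₁ := B.b - T.D.εw - 1) (t := t) one_pos (by linarith)]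
        exact hw_b.symm,
      εw_le_δw := le_rfl,
      δw_lt := hδw_lt,
      δw_lt_m₀ := by rw [hm₀]; linarith,
      tube_top := htube_top,
      ρ_contDiff := MidProfiles.contDiff_rhoProf haRpos,
      ρ_nonneg := fun A => (MidProfiles.rhoProf_pos haRpos A).le,
      ρ_deriv_nonpos := MidProfiles.deriv_rhoProf_nonpos haRpos,
      ρ_eq_inv := fun A hA => MidProfiles.rhoProf_of_ge haRpos (by linarith),
      R₀_contDiff := MidProfiles.contDiff_RProf,
      R₀_pos := MidProfiles.RProf_pos,
      R₀_deriv_nonpos := MidProfiles.deriv_RProf_nonpos hK0 hε₀pos,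
      R₀_eq_one := fun A hA => MidProfiles.RProf_of_ge hε₀pos hA,
      design := hdesign, radial := hradial, C_pos := one_pos, abs_deriv_le := hLb, hκ := hκb,
      plateau := hplateau,
      g₀_eq := hg₀, δg_pos := one_pos,
      hκδ := hκδ',
      g_form := fun j y hys hlt => hform j y hys (by linarith) }

end BiCollar.TriData.TubeFrame

end Params

/-! ### The rescaled self-indexing Morse function -/

variable (X : Type u) [TopologicalSpace X] [T2Space X] [SecondCountableTopology X]
  [ChartedSpace (EuclideanSpace ℝ (Fin 4)) X] [IsManifold (𝓡 4) ∞ X] [CompactSpace X] [ConnectedSpace X]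

/-- **A Morse function with critical values `3 · index`**, one critical point of index `0`, one of
index `4`, and as many of index `1` as of index `3` (a self-indexing balanced Morse function,
rescaled by `3`). [cite: GayKirby2016, §4, proof of Thm. 4] [cite: MilnorHCobordism1965, Thm. 4.8] -/
theorem exists_isMorse_apply_eq_three_mul_index :
    ∃ F : X → ℝ, IsMorse (𝓡 4) F ∧ (∀ x, IsMCriticalPt (𝓡 4) F x → F x = 3 * morseIndex (𝓡 4) F x) ∧
      (criticalSetOfIndex (𝓡 4) F 0).ncard = 1 ∧ (criticalSetOfIndex (𝓡 4) F 4).ncard = 1 ∧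
      (criticalSetOfIndex (𝓡 4) F 1).ncard = (criticalSetOfIndex (𝓡 4) F 3).ncard := by
  obtain ⟨f, hf, hsi, h0, h4, h13⟩ :=
    exists_isSelfIndexing_ncard_one_eq_ncard_three (exists_isMorse_isSelfIndexing_holds 4) X
  refine ⟨fun y => 3 * f y + 0, hf.const_mul_add (by norm_num) 0, fun x hx => ?_, ?_, ?_, ?_⟩
  · have hd : MDifferentiableAt (𝓡 4) 𝓘(ℝ, ℝ) f x := hf.contMDiff.mdifferentiableAt (by simp)
    have hx' : IsMCriticalPt (𝓡 4) f x := (isMCriticalPt_const_mul_add_iff (by norm_num) 0 hd).1 hx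
    rw [morseIndex_const_mul_add f (by norm_num) 0 x]
    show 3 * f x + 0 = _
    rw [add_zero, hsi x hx']
  · rw [hf.criticalSetOfIndex_const_mul_add (by norm_num) 0 0]; exact h0
  · rw [hf.criticalSetOfIndex_const_mul_add (by norm_num) 0 4]; exact h4
  · rw [hf.criticalSetOfIndex_const_mul_add (by norm_num) 0 1, hf.criticalSetOfIndex_const_mul_add (by norm_num) 0 3]
    exact h13

/-- The gap below `b` of the critical values of a Morse function on a compact manifold. [folklore] -/
theorem exists_gap_of_criticalValues {N : Type u} [TopologicalSpace N] [T2Space N] [CompactSpace N]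
    [ChartedSpace (EuclideanSpace ℝ (Fin 3)) N] [IsManifold (𝓡 3) ∞ N] {φ : N → ℝ} (hφ : IsMorse (𝓡 3) φ) (b : ℝ) :
    ∃ γ : ℝ, 0 < γ ∧ ∀ y, IsMCriticalPt (𝓡 3) φ y → φ y < b → φ y ≤ b - γ := by
  set S : Set N := {y | IsMCriticalPt (𝓡 3) φ y ∧ φ y < b} with hS
  have hfin : S.Finite := (IsMorse.finite_criticalSet_holds hφ).subset fun y hy => hy.1
  by_cases hne : S.Nonempty
  · obtain ⟨y₀, hy₀, hmax⟩ := S.exists_max_image φ hfin hne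
    refine ⟨b - φ y₀, by linarith [hy₀.2], fun y hy hyb => ?_⟩
    have : φ y ≤ φ y₀ := hmax y ⟨hy, hyb⟩
    linarith
  · refine ⟨1, one_pos, fun y hy hyb => ?_⟩
    exact absurd ⟨y, hy, hyb⟩ hne

/-! ### The theorem -/

/-- **Gay–Kirby 2016, Thm. 4 (existence), in the form produced by the construction of Lemma 14
with the Heegaard splitting of the level stabilised as far as possible towards balance: every
closed connected smooth `4`-manifold admits a `(g; k₁, k₂, k₁)`-trisection with
`k₁ ≤ k₂ ≤ g`** (`k₂ = g - m`, `m` the number of `2`-handles; the genus is raised to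
`max gen₀ (k₁ + m)` by `exists_heegaardData_add`, so the trisection is balanced as soon as the
genus `gen₀` of the Heegaard function of `TubeSystem.exists_heegaardFunction` does not exceed
`k₁ + m`; in the remaining case Gay–Kirby raise `k₁` and `m` by cancelling `1`–`2` pairs, p. 14,
which is not carried out here). [cite: GayKirby2016, Thm. 4; §4, Lemmas 13–14 and p. 14] -/
theorem exists_isGKTrisection :
    ∃ (g k₁ k₂ : ℕ) (S : Fin 3 → Set X), k₁ ≤ k₂ ∧ k₂ ≤ g ∧ IsGKTrisection X g ![k₁, k₂, k₁] S := by
  classical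
  -- (1) the Morse function
  obtain ⟨F, hFM, hFval, hF0, hF4, hF13⟩ := exists_isMorse_apply_eq_three_mul_index X
  have hFs : ContMDiff (𝓡 4) 𝓘(ℝ, ℝ) ∞ F := hFM.contMDiff
  set k₁ : ℕ := (criticalSetOfIndex (𝓡 4) F 1).ncard with hk₁
  -- indices are at most `4`
  have hidx4 : ∀ x, morseIndex (𝓡 4) F x ≤ 4 := fun x => by
    have := morseIndex_le_finrank (I := 𝓡 4) F x
    rwa [finrank_euclideanSpace_fin] at this
  -- (2) a gradient-like field and the frame data at the critical value `6`
  obtain ⟨ζ, hζgl⟩ := hFM.exists_isGradientLike (fun p _ => BoundarylessManifold.isInteriorPoint)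
  have hζs := ζ.contMDiff
  have hv : ∀ q, IsMCriticalPt (𝓡 4) F q → F q = 6 → morseIndex (𝓡 4) F q = 2 := by
    intro q hq h6
    have h := hFval q hq
    rw [h6] at h
    have : (morseIndex (𝓡 4) F q : ℝ) = 2 := by linarith
    exact_mod_cast this
  have hsep : ∀ q, IsMCriticalPt (𝓡 4) F q → F q ≠ 6 → 1 ≤ |F q - 6| := by
    intro q hq hne
    have h := hFval q hq
    have hi : morseIndex (𝓡 4) F q ≠ 2 := by
      intro h2; rw [h2] at h; norm_num at h; exact hne h
    have hcase : morseIndex (𝓡 4) F q ≤ 1 ∨ 3 ≤ morseIndex (𝓡 4) F q := by omega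
    rcases hcase with hle | hge
    · have : (morseIndex (𝓡 4) F q : ℝ) ≤ 1 := by exact_mod_cast hle
      rw [abs_of_neg (by linarith)]; linarith
    · have : (3 : ℝ) ≤ morseIndex (𝓡 4) F q := by exact_mod_cast hge
      rw [abs_of_pos (by linarith)]; linarith
  obtain ⟨m, R, η₀, hR, hη₀, hframe⟩ := exists_handleBoxes_tubeSystem hFM hζgl hv hsep
  -- (3) the height `η`
  set η : ℝ := min η₀ (min (R ^ 2 / 82) (1 / 16)) with hηdef
  have hηpos : 0 < η := lt_min hη₀ (lt_min (by positivity) (by norm_num))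
  have hηle₀ : η ≤ η₀ := min_le_left _ _
  have hηR : 82 * η ≤ R ^ 2 := by
    have : η ≤ R ^ 2 / 82 := (min_le_right _ _).trans (min_le_left _ _)
    linarith
  have hη16 : η ≤ 1 / 16 := (min_le_right _ _).trans (min_le_right _ _)
  obtain ⟨H, TS, hchart, hcentre, hTSR, hcptv, hrange⟩ := hframe η hηpos hηle₀
  -- (4) the level `a = 6 - η` is regular and connected
  have hcritval : ∀ x, IsMCriticalPt (𝓡 4) F x → F x = 6 - η → False := by
    intro x hx hxa
    have h := hFval x hx
    rcases Nat.lt_or_ge (morseIndex (𝓡 4) F x) 2 with hlt | hge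
    · have : (morseIndex (𝓡 4) F x : ℝ) ≤ 1 := by exact_mod_cast Nat.lt_succ_iff.1 hlt
      linarith
    · have : (2 : ℝ) ≤ morseIndex (𝓡 4) F x := by exact_mod_cast hge
      linarith
  have ha : IsRegularLevel (𝓡 4) F (6 - η) :=
    ⟨hFs, fun x _ => BoundarylessManifold.isInteriorPoint, fun x hx hc => hcritval x hc hx⟩
  haveI : ConnectedSpace (RegularLevel ha) := by
    refine connectedSpace_regularLevel (k := 3) hFM ha ?_ (fun z hz hza => ?_) ?_
    · exact (Set.ncard_eq_one.1 hF0).elim fun x hx => by rw [hx]; exact subsingleton_singleton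
    · have h := hFval z hz
      have : (morseIndex (𝓡 4) F z : ℝ) < 2 := by linarith
      have : morseIndex (𝓡 4) F z < 2 := by exact_mod_cast this
      show morseIndex (𝓡 4) F z + 2 ≤ 3 + 1
      omega
    · obtain ⟨x, hx⟩ := Set.ncard_eq_one.1 hF0
      have hxc : x ∈ criticalSetOfIndex (𝓡 4) F 0 := by rw [hx]; exact mem_singleton x
      obtain ⟨hxcrit, hx0⟩ := mem_criticalSetOfIndex.1 hxc
      refine ⟨x, ?_⟩
      have h := hFval x hxcrit
      rw [hx0] at h; norm_num at h; rw [h]; linarith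
  -- (5) belt radii and slope bounds, the tube amplitude `εT`
  obtain ⟨Lχ, hLχ0, hLχ⟩ := exists_abs_deriv_smoothTransition_comp_le (r₀ := η / 16) (r₁ := η / 8) (by linarith)
  obtain ⟨Lχ₂, hLχ₂0, hLχ₂⟩ := exists_abs_deriv_one_sub_smoothTransition_comp_le (r₂ := η / 16) (r₃ := η / 8) (by linarith)
  set εT : ℝ := min (1 / 100) (1 / (32 * η * (Lχ + 1))) with hεTdef
  have hεTpos : 0 < εT := lt_min (by norm_num) (by positivity)
  have hεT1 : εT ≤ 1 / 100 := min_le_left _ _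
  have hεTL : εT ≤ 1 / (32 * η * (Lχ + 1)) := min_le_right _ _
  -- (6) the Heegaard data, of genus `max gen₀ (k₁ + m)`
  obtain ⟨gen₀, hdata⟩ := exists_heegaardData_add TS ha (by rw [hTSR]; exact hηR) hεTpos hεT1
  obtain ⟨φ, b, hb, hφM, hΓφ, hbhalf, hb1, hbelow, habove, hφtube, hH₁₂, hH₃₁, hgen, hlevel, hconn₁, hconn₂⟩ :=
    hdata (k₁ + m - gen₀)
  obtain ⟨γ, hγ, hγle⟩ := exists_gap_of_criticalValues hφM b
  -- (7) the unit fields and the bi-collar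
  obtain ⟨U₁, ρU, hρUs, hρUpos, hUeq, hUgl⟩ := exists_levelUnitField_smul hFM hζs hζgl ha
  set δ' : ℝ := min U₁.δ (η / 32) with hδ'def
  have hδ'pos : 0 < δ' := lt_min U₁.δ_pos (by positivity)
  have hδ'le : δ' ≤ U₁.δ := min_le_left _ _
  have hδ'η : δ' ≤ η / 32 := min_le_right _ _
  set U : LevelUnitField 3 F (6 - η) := U₁.shrink δ' hδ'pos hδ'le with hUdef
  obtain ⟨V⟩ := hb.exists_levelUnitField
  haveI : Nonempty (RegularLevel hb) := by
    obtain ⟨y, hy⟩ := hlevel.nonempty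
    exact ⟨⟨y, hy⟩⟩
  set B₀ : BiCollar X := ⟨F, 6 - η, ha, U, φ, b, hb, V, inferInstance⟩ with hB₀def
  have hFr₀ : B₀.MorseFrame := ⟨hFM, hUgl⟩
  -- (8) the levels `a < c`, the `TriData`
  set ν : ℝ := Real.sqrt η / 2 with hνdef
  have hνpos : 0 < ν := by rw [hνdef]; have := Real.sqrt_pos.2 hηpos; positivity
  have hν2 : ν ^ 2 = η / 4 := by
    rw [hνdef, div_pow, Real.sq_sqrt hηpos.le]; norm_num
  set c : ℝ := (6 - η) + η + ν ^ 2 with hcdef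
  have hac : B₀.a < c := by show 6 - η < (6 - η) + η + ν ^ 2; rw [hν2]; linarith only [hηpos]
  have hcval : c = 6 + η / 4 := by rw [hcdef, hν2]; ring
  have hreg : ∀ x, B₀.f x = c → ¬ IsMCriticalPt (𝓡 4) B₀.f x := by
    intro x hxc hx
    have h := hFval x hx
    change F x = c at hxc
    rw [hxc, hcval] at h
    rcases Nat.lt_or_ge (morseIndex (𝓡 4) F x) 3 with hlt | hge
    · have h' : (morseIndex (𝓡 4) F x : ℝ) ≤ 2 := by exact_mod_cast Nat.lt_succ_iff.1 hlt
      linarith only [h, h', hηpos]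
    · have h' : (3 : ℝ) ≤ morseIndex (𝓡 4) F x := by exact_mod_cast hge
      linarith only [h, h', hη16]
  set ηoL : ℝ := min (9 / 56) γ with hηoLdef
  have hηoL : 0 < ηoL := lt_min (by norm_num) hγ
  have hgw : (0 : ℝ) < 2 := two_pos
  -- handle counts of `F` below `a` and above `c`
  have hbelow_iff : ∀ x, IsMCriticalPt (𝓡 4) F x → (F x < 6 - η ↔ morseIndex (𝓡 4) F x ≤ 1) := by
    intro x hx
    have h := hFval x hx
    constructor
    · intro hlt
      by_contra hgt; push Not at hgt
      have h' : (2 : ℝ) ≤ morseIndex (𝓡 4) F x := by exact_mod_cast hgt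
      linarith only [h, h', hlt, hηpos]
    · intro hle
      have h' : (morseIndex (𝓡 4) F x : ℝ) ≤ 1 := by exact_mod_cast hle
      linarith only [h, h', hη16]
  have habove_iff : ∀ x, IsMCriticalPt (𝓡 4) F x → (c < F x ↔ 3 ≤ morseIndex (𝓡 4) F x) := by
    intro x hx
    have h := hFval x hx
    rw [hcval]
    constructor
    · intro hlt
      by_contra hle; push Not at hle
      have h' : (morseIndex (𝓡 4) F x : ℝ) ≤ 2 := by exact_mod_cast Nat.lt_succ_iff.1 hle
      linarith only [h, h', hlt, hηpos]
    · intro hge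
      have h' : (3 : ℝ) ≤ morseIndex (𝓡 4) F x := by exact_mod_cast hge
      linarith only [h, h', hη16]
  have hcount_below : ∀ i, (criticalSetOfIndex (𝓡 4) F i ∩ F ⁻¹' Iio (6 - η)).ncard = handleCount 1 k₁ i := by
    intro i
    by_cases hi : i ≤ 1
    · have heq : criticalSetOfIndex (𝓡 4) F i ∩ F ⁻¹' Iio (6 - η) = criticalSetOfIndex (𝓡 4) F i := by
        refine inter_eq_left.2 fun x hx => ?_
        obtain ⟨hxc, hxi⟩ := mem_criticalSetOfIndex.1 hx
        exact (hbelow_iff x hxc).2 (hxi ▸ hi)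
      rw [heq]
      interval_cases i
      · simpa [handleCount] using hF0
      · simp [handleCount, hk₁]
    · have heq : criticalSetOfIndex (𝓡 4) F i ∩ F ⁻¹' Iio (6 - η) = ∅ := by
        refine Set.eq_empty_of_forall_notMem fun x hx => ?_
        obtain ⟨hxc, hxi⟩ := mem_criticalSetOfIndex.1 hx.1
        have := (hbelow_iff x hxc).1 hx.2
        omega
      rw [heq, ncard_empty]
      simp only [handleCount]
      rw [if_neg (by omega), if_neg (by omega)]
  have hcount_above : ∀ i, 3 ≤ i → (criticalSetOfIndex (𝓡 4) F i ∩ F ⁻¹' Ioi c).ncard = (criticalSetOfIndex (𝓡 4) F i).ncard := by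
    intro i hi
    congr 1
    refine inter_eq_left.2 fun x hx => ?_
    obtain ⟨hxc, hxi⟩ := mem_criticalSetOfIndex.1 hx
    exact (habove_iff x hxc).2 (hxi ▸ hi)
  have hcount_above' : ∀ i, i ≤ 2 → (criticalSetOfIndex (𝓡 4) F i ∩ F ⁻¹' Ioi c).ncard = 0 := by
    intro i hi
    have heq : criticalSetOfIndex (𝓡 4) F i ∩ F ⁻¹' Ioi c = ∅ := by
      refine Set.eq_empty_of_forall_notMem fun x hx => ?_
      obtain ⟨hxc, hxi⟩ := mem_criticalSetOfIndex.1 hx.1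
      have := (habove_iff x hxc).1 hx.2
      omega
    rw [heq, ncard_empty]
  have hgapF : ∀ q, IsMCriticalPt (𝓡 4) F q → F q ≤ c ∨ c + 5 / 2 < F q := by
    intro q hq
    have h := hFval q hq
    rw [hcval]
    rcases Nat.lt_or_ge (morseIndex (𝓡 4) F q) 3 with hlt | hge
    · left
      have h' : (morseIndex (𝓡 4) F q : ℝ) ≤ 2 := by exact_mod_cast Nat.lt_succ_iff.1 hlt
      linarith only [h, h', hηpos]
    · right
      have h' : (3 : ℝ) ≤ morseIndex (𝓡 4) F q := by exact_mod_cast hge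
      linarith only [h, h', hη16]
  set B : BiCollar X := BiCollar.shrunk B₀ c hac with hBdef
  set T : B.TriData := BiCollar.TriData.ofLevels hFr₀ hac hreg hηoL hgw with hTdef
  -- basic identifications
  have hBf : B.f = F := rfl
  have hBa : B.a = 6 - η := rfl
  have hBg : B.g = φ := rfl
  have hBb : B.b = b := rfl
  have hTc : T.c = c := rfl
  have hBδ : B.U.δ ≤ δ' := BiCollar.δ₀_le
  have hBδη : B.U.δ ≤ η / 32 := hBδ.trans hδ'η
  have hBξ : ∀ x, B.U.ξ x = ρU x • ζ x := fun x => hUeq x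
  have hTε : T.ε ≤ (c - (6 - η)) / 4 ∧ T.ε ≤ ηoL / 2 ∧ T.ε ≤ 2 / 4 := BiCollar.εOf_le
  have hTε' : T.ε ≤ 5 * η / 16 := by have h := hTε.1; rw [hcval] at h; linarith only [h]
  have hTεγ : T.ε ≤ γ / 2 := by have h := hTε.2.1; have h' : ηoL ≤ γ := min_le_right _ _; linarith only [h, h']
  have hTεm : T.ε ≤ 9 / 112 := by have h := hTε.2.1; have h' : ηoL ≤ 9 / 56 := min_le_left _ _; linarith only [h, h']
  have hεwδ : T.D.εw ≤ B.U.δ := T.D.εw_le_δU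
  -- coordinates of the boxes versus the tube system
  have hext : ∀ j (x : X), (H.box j).chart.extend (𝓡 4) x = (H.box j).chart x := fun j x => by simp
  have hcoord : ∀ j (x : X), TS.centred j x = (H.box j).coord x := fun j x => by
    rw [TubeSystem.centred_apply, hchart, hcentre, MilnorBox.coord, hext, hext]
  have hAB : ∀ j (x : X), H.P j x = ((H.box j).coord x 0 ^ 2 + (H.box j).coord x 1 ^ 2) *
      ((H.box j).coord x 2 ^ 2 + (H.box j).coord x 3 ^ 2) := fun j x => by
    rw [HandleBoxes.P_def, HandleBoxes.A_def, HandleBoxes.B_def, H.k_eq j, sqSumLT_two_apply, sqSumGE_two_apply]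
  have htube_le : ∀ j (x : X), TubeModel.tube εT (1 / (4 * η)) η ((H.box j).coord x) ≤ 1 + 1 / (4 * η ^ 2) * H.P j x := by
    intro j x
    have h := (TubeModel.tube_sub_mem_Icc hεTpos.le (1 / (4 * η)) η ((H.box j).coord x)).2
    rw [hAB]
    have : 1 / (4 * η) / η = 1 / (4 * η ^ 2) := by field_simp
    rw [this] at h
    linarith only [h]
  have htube_lt : ∀ j (x : X), H.P j x < η ^ 2 → TubeModel.tube εT (1 / (4 * η)) η ((H.box j).coord x) < 5 / 4 := by
    intro j x hP
    have h := htube_le j x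
    have : 1 / (4 * η ^ 2) * H.P j x < 1 / 4 := by
      rw [div_mul_eq_mul_div, one_mul, div_lt_iff₀ (by positivity)]; linarith only [hP]
    linarith only [h, this]
  have hφform : ∀ j (y : B.Y), RegularLevel.incl B.hf y ∈ (H.box j).chart.source →
      TubeModel.tube εT (1 / (4 * η)) η ((H.box j).coord (RegularLevel.incl B.hf y)) < 3 →
      B.g y = 1 / 7 * TubeModel.tube εT (1 / (4 * η)) η ((H.box j).coord (RegularLevel.incl B.hf y)) := by
    intro j y hys hlt
    have hys' : y.1 ∈ (TS.chart j).source := by rw [hchart]; exact hys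
    have h := hφtube j y hys' (by rw [hcoord]; exact hlt)
    rw [hcoord] at h
    exact h
  -- (9) the tube frame
  set 𝔉 : T.TubeFrame (Fin m) :=
    { ζ := fun x => ζ x, hζ := hζs, hgl := hζgl, ρU := ρU, continuous_ρU := hρUs.continuous, ρU_pos := hρUpos,
      U_eq := hBξ, η₂ := η, boxes := H, band_le := by linarith only [hBδη, hηpos], ν := ν, ν_pos := hνpos,
      two_nu_sq_le := by rw [hν2]; linarith only [hηpos], c_eq := by rw [hTc, hBa],
      kg := 1 / 7, g₀ := 0, εT := εT, κT := 1 / (4 * η), P₀ := η ^ 2, m₀ := 9 / 28,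
      kg_pos := by norm_num, εT_nonneg := hεTpos.le, κT_pos := by positivity, P₀_pos := by positivity, P₀_le := le_rfl,
      g_tube := fun j y hys hP => by
        have h := hφform j y hys ((htube_lt j _ hP).trans (by norm_num))
        rw [add_zero]; exact h,
      g_margin := fun j y hys hP => by
        have h := hφform j y hys ((htube_lt j _ hP).trans (by norm_num))
        have h' := htube_lt j _ hP
        rw [h]; change _ ≤ b - 9 / 28; linarith only [h', hbhalf],
      lt_m₀ := by linarith only [hTεm],
      critgap := fun y hy hyb => by
        have h := hγle y hy hyb
        change φ y ≤ b - 2 * T.ε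
        linarith only [h, hTεγ] } with h𝔉def
  -- (10) the belt parameters, (11) the middle-sector parameters
  have hεw' : T.D.εw < 9 / 28 := lt_of_le_of_lt (hεwδ.trans hBδη) (by linarith only [hη16])
  obtain ⟨𝔓⟩ := 𝔉.nonempty_beltParams rfl rfl rfl rfl rfl hν2 hεT1 hbhalf hεw' hLχ0 hLχ hLχ₂0 hLχ₂ hεTL
  obtain ⟨Lb, hLb, hκb⟩ := BiCollar.TriData.ofLevels_D_small hFr₀ hac hreg hηoL hgw
  obtain ⟨𝔔⟩ := 𝔉.nonempty_midParams rfl rfl rfl rfl rfl hν2 hεT1 hbhalf hη16 hBδη hTε' hLb hκb hφform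
  -- (12) the hypotheses of the assembly
  have hsurf : IsConnected B.surface := by
    haveI : ConnectedSpace B.F := isConnected_iff_connectedSpace.1 hlevel
    exact isConnected_range ((RegularLevel.isEmbedding_incl B.hf).continuous.comp (RegularLevel.isEmbedding_incl B.hg).continuous)
  have hΓ : ∀ x, |B.gFun x| ≤ 1 := fun x => hΓφ (B.lamLift x)
  have hσ : 0 < B.U.δ / 2 := half_pos B.U.δ_pos
  have hgap : ∀ q, IsMCriticalPt (𝓡 4) B.f q → B.f q ≤ T.c ∨ T.c + 1 + T.ε + B.U.δ / 2 < B.f q := by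
    intro q hq
    rcases hgapF q hq with h | h
    · exact Or.inl h
    · right
      change c + 1 + T.ε + B.U.δ / 2 < F q
      linarith only [h, hTεm, hBδη, hη16]
  -- (13) assemble
  obtain ⟨k₂, hk₂m, hGK⟩ := 𝔉.exists_isGKTrisection_of_params 𝔓 𝔔 hφM hεTpos hbelow hsurf hgen hH₁₂ hH₃₁
    hcount_below hΓ hσ (le_of_eq (by ring)) hgap
    ((hcount_above 4 (by norm_num)).trans hF4) ((hcount_above 3 le_rfl).trans hF13.symm)
    (fun i hi => hcount_above' i hi)
  refine ⟨gen₀ + (k₁ + m - gen₀), k₁, k₂, T.sectors, ?_, ?_, hGK⟩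
  · change k₂ + Fintype.card (Fin m) = gen₀ + (k₁ + m - gen₀) at hk₂m
    rw [Fintype.card_fin] at hk₂m
    omega
  · change k₂ + Fintype.card (Fin m) = gen₀ + (k₁ + m - gen₀) at hk₂m
    omega

/-- **The trisection genus of a closed connected smooth `4`-manifold is finite** (Gay–Kirby,
Remark 2 with Thm. 4). [cite: GayKirby2016, Thm. 4 and Remark 2] -/
theorem gkTrisectionGenus_ne_top : gkTrisectionGenus X ≠ ⊤ := by
  obtain ⟨g, k₁, k₂, S, -, -, h⟩ := exists_isGKTrisection X
  have hle : gkTrisectionGenus X ≤ g :=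
    iInf_le_of_le g (iInf_le_of_le _ (iInf_le_of_le S (iInf_le_of_le h le_rfl)))
  exact ne_top_of_le_ne_top (ENat.coe_ne_top g) hle

end Literature.Topology.FourManifolds

end
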